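import Mathlib
import HarnessLib
import Summits.AtomisticToContinuum.FouriersLaw.Theses.JunctionLocality
import Summits.AtomisticToContinuum.FouriersLaw.Theorems.JunctionLocalitySuperadditiveResistanceStubTerminationLocalityAux5

/-!
# Probe-removal cost in the κ-frame, helper I: the EXACT floating-probe insertion identity
(helper `--supports` stmt-AtomisticToContinuum-11748 for stub `stub_probeRemovalCost` (S3') of line
`floating-probe-bypass-laplacian`, skeleton v7, crux `JunctionLocality.SuperadditiveResistance`)

S3' compares, `N`-uniformly and eventually in `κ → 0⁺`, the floating two-terminal conductance of the γ-probed
`(N, M)`-device (read off the resolvent Kubo matrix `K(κ)` in Schur variables `a = K₀₀`, `b = K₃₃`, `x = −K₀₃`) with the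
plain `(N+M)`-chain's Kubo conductance `G_L = plainKubo … (N+M) gL` (`gL` a left forward field of the WHOLE chain,
`L^{T,T}_{N+M} gL = −(p_0² − T)`). Unlike S1'/S2' (helpers `…StubTerminationLocalityAux5/6`, `…StubBypassBoundAux4/5/6`)
S3' had no exact identity isolating its `N`-uniform content. This file proves the κ-frame analogue of the sibling line's
insertion identity (`insertionIdentity_of_kuboFrame`, there at `κ = 0` with exact device fields), at FIXED `N, M, κ`:

* `bathOp_deviceWeight` — the device's thermostat operator splits as the plain chain's plus the PROBE-PAIR operator
  `S_K = S_{N−1} + S_N` (`bathOp` with weights `𝟙_{N−1} + 𝟙_N`), pointwise;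
* `deviceResolvent_plainPair` — hence a `κ`-resolvent field `g_0` of bath `0` of the device
  (`κ g_0 − L_dev g_0 = p_0² − T`) is a forward pair of the PLAIN chain with source `(p_0² − T) − κ g_0 + γ S_K g_0`;
* `insertion_pairing` — for `gL ∈ C² ∩ L²` with `L^{T,T} gL = −(p_0² − T)` and `g_0` as above with `S_K g_0 ∈ L²(μ_T)`:
  `⟨g_0, p_0² − T⟩ − ⟨gL, p_0² − T⟩ = γ ⟨gL∘R, S_K g_0⟩ − κ ⟨gL∘R, g_0⟩` (all pairings in `L²(μ_T^{(N+M)})`, `R` the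
  momentum reversal): the landed cross Green identity `Kubo.cross` at the PLAIN weights for the forward pair `g_0` against
  the backward pair `gL∘R` (source `p_0² − T`, even), plus reversal invariance of `μ_T`;
* **`kuboMatrix_zero_zero_sub_plainKubo_insertion`** — THE INSERTION IDENTITY
  `K₀₀(κ) − G_L = −(γ³/T²) ⟨gL∘R, S_K g_0⟩_{μ_T} + (γ²/T²) κ ⟨gL∘R, g_0⟩_{μ_T}`:
  the self-conductance of bath `0` in the probed device exceeds (or falls short of) the unprobed chain's conductance
  EXACTLY by the pairing of the plain chain's (reversed) forward field with the probe-pair OU operator applied to the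
  device field — a functional localised at the two probe momenta — plus a mass term that is invisible eventually in `κ`.
  With the resolvent row sum (`kubo_onsager_resolvent`) the same pairing also gives `x − G_L` and the transfers
  `u = −(K₀₁ + K₀₂)`, so the whole `N`-uniform content of S3' (`1/G_float − 1/G_L ≤ C₂`, connectivity margin) sits in
  bounds on `⟨gL∘R, S_K g_a⟩`, `a ∈ {0, 3}`, relative to `a G_L`, `b G_L` — the κ-frame form of the sibling line's
  α-leg (`roughness × curvature`), cf. `Lines/thermalise_then_cut_probe_insertion.lean`.

REGULARITY INPUT (explicit hypothesis, not a named fact): `S_K g_0 ∈ L²(μ_T)` — square integrability of the SECOND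
momentum derivatives of the device resolvent field at the two thermostatted probe momenta (the sibling line carries the
same clause inside `IsForwardField`; the resolvent frame `deviceResolventFields` only records `C²`, `L²` and the PDE, and
the first derivatives `∂_{p_{N−1}} g_0, ∂_{p_N} g_0 ∈ L²` that the landed energy identity gives are one order short).
Fixed-`N` statements, standard axioms, no definitions, nothing taken as a named fact.
-/

noncomputable section

open MeasureTheory Filter Topology
open scoped ContDiff
open Literature.MathematicalPhysics.KineticTheory.HeatConduction
open Summit.AtomisticToContinuum.FouriersLaw.Theorems.SuperadditiveResistance.DeviceLiouville
  (kin deviceGenerator deviceWeight deviceGenerator_eq kin_eq_sq liouvilleOp bathOp generator_eq_liouvilleOp_add)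
open Summit.AtomisticToContinuum.FouriersLaw.Theorems.SuperadditiveResistance.Kubo
  (rev rev_apply contDiff_rev memLp_rev rev_pair cross memLp_partialP integrable_mul_mul_gibbsDensity
    integral_rev_mul_gibbsDensity)

namespace Summit.AtomisticToContinuum.FouriersLaw.Cruxes.SuperadditiveResistance.FloatingProbeBypassLaplacian

variable {ω₂ lam β γ T : ℝ} {N M : ℕ}

/-! ## The probe-pair operator inside the device's thermostat operator -/

/-- **`S_{B_dev} = S_{B_plain} + S_K` pointwise**: the device's weighted thermostat operator is the plain chain's
(weights `bathWeight`: sites `0`, `N+M−1`) plus the probe-pair operator (weights `𝟙_{N−1} + 𝟙_N`). -/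
theorem bathOp_deviceWeight (N M : ℕ) (T : ℝ) (f : PhaseSpace (N + M) → ℝ) (x : PhaseSpace (N + M)) :
    bathOp (N + M) (deviceWeight N M) T f x =
      bathOp (N + M) (OscillatorChain.bathWeight (N + M)) T f x +
        bathOp (N + M) (fun i : Fin (N + M) =>
          (if i.val = N - 1 then (1 : ℝ) else 0) + (if i.val = N then (1 : ℝ) else 0)) T f x := by
  unfold bathOp deviceWeight
  rw [← Finset.sum_add_distrib]
  refine Finset.sum_congr rfl fun i _ => ?_
  ring

/-- **A device resolvent field is a plain forward pair with a probe source.** If `κ g_0 − L_dev g_0 = p_0² − T`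
pointwise then `X_H g_0 + γ S_{B_plain} g_0 = −((p_0² − T) − κ g_0 + γ S_K g_0)`. -/
theorem deviceResolvent_plainPair (ω₂ lam β γ T κ : ℝ) {g₀ : PhaseSpace (N + M) → ℝ}
    (hpde₀ : ∀ x, κ * g₀ x - deviceGenerator (pinnedChain ω₂ lam β γ) N M (fun _ => T) g₀ x =
      kin (N + M) 0 x - T)
    (x : PhaseSpace (N + M)) :
    1 * liouvilleOp (pinnedChain ω₂ lam β γ) (N + M) g₀ x +
        γ * bathOp (N + M) (OscillatorChain.bathWeight (N + M)) T g₀ x =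
      -((kin (N + M) 0 x - T) - κ * g₀ x +
        γ * bathOp (N + M) (fun i : Fin (N + M) =>
          (if i.val = N - 1 then (1 : ℝ) else 0) + (if i.val = N then (1 : ℝ) else 0)) T g₀ x) := by
  have h := hpde₀ x
  rw [deviceGenerator_eq, bathOp_deviceWeight] at h
  have hγ' : (pinnedChain ω₂ lam β γ).γ = γ := rfl
  rw [hγ'] at h
  linarith

/-- The momentum reversal of a plain forward field of bath `0` is a BACKWARD plain pair with the same (even) source:
`−X_H (gL∘R) + γ S_{B_plain} (gL∘R) = −(p_0² − T)`. -/
theorem plainForwardField_rev_pair (ω₂ lam β γ T : ℝ) {L : ℕ} {gL : PhaseSpace L → ℝ}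
    (hpde : ∀ x, (pinnedChain ω₂ lam β γ).generator L T T gL x = -(kin L 0 x - T)) (x : PhaseSpace L) :
    -1 * liouvilleOp (pinnedChain ω₂ lam β γ) L (rev gL) x +
        γ * bathOp L (OscillatorChain.bathWeight L) T (rev gL) x = -(kin L 0 x - T) := by
  have hpair : ∀ y, 1 * liouvilleOp (pinnedChain ω₂ lam β γ) L gL y +
      γ * bathOp L (OscillatorChain.bathWeight L) T gL y = -(kin L 0 y - T) := by
    intro y
    rw [← hpde y, generator_eq_liouvilleOp_add]
    have : (pinnedChain ω₂ lam β γ).γ = γ := rfl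
    rw [this, one_mul]
  have h := rev_pair (pinnedChain ω₂ lam β γ) (OscillatorChain.bathWeight L) T 1 γ
    (k := fun y => kin L 0 y - T) hpair x
  rw [h, rev_apply, kin_neg_snd]

/-! ## The Green pairing -/

/-- **The insertion pairing (fixed `N`, `M`, `κ`; exact).** For the pinned chain (`ω₂ > 0`, `lam, β ≥ 0`,
`γ, T > 0`), a classical `κ`-resolvent field `g_0 ∈ C² ∩ L²(μ_T)` of bath `0` of the `(N, M)`-device with
`S_K g_0 ∈ L²(μ_T)`, and a classical `gL ∈ C² ∩ L²(μ_T)` with `L^{T,T}_{N+M} gL = −(p_0² − T)`: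
`⟨g_0, p_0² − T⟩ − ⟨gL, p_0² − T⟩ = γ⟨gL∘R, S_K g_0⟩ − κ⟨gL∘R, g_0⟩`. -/
theorem insertion_pairing (hω : 0 < ω₂) (hl : 0 ≤ lam) (hβ : 0 ≤ β) (hγ : 0 < γ) (hT : 0 < T) (κ : ℝ)
    {g₀ : PhaseSpace (N + M) → ℝ} (hg₀C : ContDiff ℝ 2 g₀)
    (hg₀L : MemLp g₀ 2 ((pinnedChain ω₂ lam β γ).gibbsMeasure (N + M) T))
    (hpde₀ : ∀ x, κ * g₀ x - deviceGenerator (pinnedChain ω₂ lam β γ) N M (fun _ => T) g₀ x =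
      kin (N + M) 0 x - T)
    (hSK : MemLp (bathOp (N + M) (fun i : Fin (N + M) =>
        (if i.val = N - 1 then (1 : ℝ) else 0) + (if i.val = N then (1 : ℝ) else 0)) T g₀) 2
      ((pinnedChain ω₂ lam β γ).gibbsMeasure (N + M) T))
    {gL : PhaseSpace (N + M) → ℝ} (hgLC : ContDiff ℝ 2 gL)
    (hgLL : MemLp gL 2 ((pinnedChain ω₂ lam β γ).gibbsMeasure (N + M) T))
    (hpdeL : ∀ x, (pinnedChain ω₂ lam β γ).generator (N + M) T T gL x = -(kin (N + M) 0 x - T)) :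
    (∫ x, g₀ x * (kin (N + M) 0 x - T) ∂((pinnedChain ω₂ lam β γ).gibbsMeasure (N + M) T)) -
        ∫ x, gL x * (kin (N + M) 0 x - T) ∂((pinnedChain ω₂ lam β γ).gibbsMeasure (N + M) T) =
      γ * ∫ x, gL (x.1, -x.2) * bathOp (N + M) (fun i : Fin (N + M) =>
          (if i.val = N - 1 then (1 : ℝ) else 0) + (if i.val = N then (1 : ℝ) else 0)) T g₀ x
            ∂((pinnedChain ω₂ lam β γ).gibbsMeasure (N + M) T) -
        κ * ∫ x, gL (x.1, -x.2) * g₀ x ∂((pinnedChain ω₂ lam β γ).gibbsMeasure (N + M) T) := by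
  set P := pinnedChain ω₂ lam β γ with hP
  set μ := P.gibbsMeasure (N + M) T with hμ
  -- the players
  set SK : PhaseSpace (N + M) → ℝ := bathOp (N + M) (fun i : Fin (N + M) =>
    (if i.val = N - 1 then (1 : ℝ) else 0) + (if i.val = N then (1 : ℝ) else 0)) T g₀ with hSKdef
  set k₀ : PhaseSpace (N + M) → ℝ := fun x => kin (N + M) 0 x - T with hk₀
  set kf : PhaseSpace (N + M) → ℝ := fun x => k₀ x - κ * g₀ x + γ * SK x with hkf
  -- regularity
  have hrevC : ContDiff ℝ 2 (rev gL) := contDiff_rev hgLC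
  have hrevL : MemLp (rev gL) 2 μ := memLp_rev hω hl hβ (N + M) hT hgLC.continuous hgLL
  have hk₀L : MemLp k₀ 2 μ := memLp_kin_sub hω hl hβ γ (N + M) 0 hT
  have hkfL : MemLp kf 2 μ := (hk₀L.sub (hg₀L.const_mul κ)).add (hSK.const_mul γ)
  have hB : ∀ i : Fin (N + M), 0 ≤ OscillatorChain.bathWeight (N + M) i := fun i => by
    unfold OscillatorChain.bathWeight; split_ifs <;> norm_num
  -- the two pairs at the PLAIN weights
  have hpair_f : ∀ x, 1 * liouvilleOp P (N + M) g₀ x + γ * bathOp (N + M) (OscillatorChain.bathWeight (N + M)) T g₀ x =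
      -kf x := fun x => by
    rw [hkf]
    exact deviceResolvent_plainPair ω₂ lam β γ T κ hpde₀ x
  have hpair_h : ∀ x, -1 * liouvilleOp P (N + M) (rev gL) x +
      γ * bathOp (N + M) (OscillatorChain.bathWeight (N + M)) T (rev gL) x = -k₀ x := fun x =>
    plainForwardField_rev_pair ω₂ lam β γ T hpdeL x
  -- the cross Green identity (density form): ∫ (rev gL) kf ρ = ∫ g₀ k₀ ρ
  have hcross := cross hω hl hβ (N + M) hT (OscillatorChain.bathWeight (N + M)) hB 1 hγ
    hg₀C hrevC hg₀L hrevL hkfL hk₀L hpair_f hpair_h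
  -- expand the left side
  set ρ := P.gibbsDensity (N + M) T with hρ
  have hI1 := integrable_mul_mul_gibbsDensity hω hl hβ γ (N + M) hT hrevL hk₀L
  have hI2 := integrable_mul_mul_gibbsDensity hω hl hβ γ (N + M) hT hrevL hg₀L
  have hI3 := integrable_mul_mul_gibbsDensity hω hl hβ γ (N + M) hT hrevL hSK
  have eL : ∫ x, rev gL x * kf x * ρ x =
      (∫ x, rev gL x * k₀ x * ρ x) - κ * (∫ x, rev gL x * g₀ x * ρ x) + γ * ∫ x, rev gL x * SK x * ρ x := by
    have step : ∫ x, rev gL x * kf x * ρ x =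
        ∫ x, ((rev gL x * k₀ x * ρ x - κ * (rev gL x * g₀ x * ρ x)) + γ * (rev gL x * SK x * ρ x)) :=
      integral_congr_ae (ae_of_all _ fun x => by simp only [hkf]; ring)
    have hA : Integrable (fun x => rev gL x * k₀ x * ρ x - κ * (rev gL x * g₀ x * ρ x)) :=
      hI1.sub (hI2.const_mul κ)
    have hB' : Integrable (fun x => γ * (rev gL x * SK x * ρ x)) := hI3.const_mul γ
    have hC : Integrable (fun x => κ * (rev gL x * g₀ x * ρ x)) := hI2.const_mul κ
    have hI1' : Integrable (fun x => rev gL x * k₀ x * ρ x) := hI1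
    rw [step, integral_add hA hB', integral_sub hI1' hC, integral_const_mul, integral_const_mul]
  -- reversal invariance: ∫ (rev gL) k₀ ρ = ∫ gL k₀ ρ (the source is even)
  have eRev : ∫ x, rev gL x * k₀ x * ρ x = ∫ x, gL x * k₀ x * ρ x := by
    have h := integral_rev_mul_gibbsDensity P T (L := N + M) (fun x => gL x * k₀ x)
    have e : (fun x => rev (fun x => gL x * k₀ x) x * ρ x) = fun x => rev gL x * k₀ x * ρ x := by
      funext x
      simp only [rev_apply, hk₀, kin_neg_snd]
    rw [e] at h
    exact h
  rw [eL, eRev] at hcross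
  -- back to the Gibbs measure
  rw [P.integral_gibbsMeasure, P.integral_gibbsMeasure, P.integral_gibbsMeasure, P.integral_gibbsMeasure]
  have e1 : ∫ x, gL (x.1, -x.2) * SK x * ρ x = ∫ x, rev gL x * SK x * ρ x := rfl
  have e2 : ∫ x, gL (x.1, -x.2) * g₀ x * ρ x = ∫ x, rev gL x * g₀ x * ρ x := rfl
  rw [e1, e2, ← mul_sub, mul_left_comm γ, mul_left_comm κ, ← mul_sub]
  congr 1
  linarith

/-! ## The exact κ-frame insertion identity -/

/-- **THE EXACT κ-FRAME FLOATING-PROBE INSERTION IDENTITY (bath `0`; fixed `N`, `M`, `κ`).** For the pinned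
chain (`ω₂ > 0`, `lam, β ≥ 0`, `γ, T > 0`), any family `g` whose bath-`0` member is a `κ`-resolvent field of the
`(N, M)`-device with `S_K (g 0) ∈ L²(μ_T)` (second probe-momentum derivatives square integrable) and any plain forward
field `gL` of the WHOLE `(N+M)`-chain:

  `K₀₀(κ) − G_L = −(γ³/T²)·⟨gL∘R, S_K (g 0)⟩_{μ_T} + (γ²/T²)·κ·⟨gL∘R, g 0⟩_{μ_T}`,

`S_K = S_{N−1} + S_N` the probe-pair Ornstein–Uhlenbeck operator (`bathOp` with weights `𝟙_{N−1} + 𝟙_N`), `R` the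
momentum reversal. The right-block identity (`K₃₃` against the chain read from its right bath) is this one for the
block-swapped device (`…StubTerminationLocalityAux2/3/6`). -/
theorem kuboMatrix_zero_zero_sub_plainKubo_insertion (hω : 0 < ω₂) (hl : 0 ≤ lam) (hβ : 0 ≤ β) (hγ : 0 < γ)
    (hT : 0 < T) (κ : ℝ) (g : Fin 4 → PhaseSpace (N + M) → ℝ) (gL : PhaseSpace (N + M) → ℝ)
    (hg₀ : g 0 ∈ deviceResolventFields ω₂ lam β γ T N M 0 κ)
    (hSK : MemLp (bathOp (N + M) (fun i : Fin (N + M) =>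
        (if i.val = N - 1 then (1 : ℝ) else 0) + (if i.val = N then (1 : ℝ) else 0)) T (g 0)) 2
      ((pinnedChain ω₂ lam β γ).gibbsMeasure (N + M) T))
    (hgL : gL ∈ plainForwardFields ω₂ lam β γ T (N + M)) :
    kuboMatrix ω₂ lam β γ T N M g 0 0 - plainKubo ω₂ lam β γ T (N + M) gL =
      -(γ ^ 3 / T ^ 2) * ∫ x, gL (x.1, -x.2) * bathOp (N + M) (fun i : Fin (N + M) =>
          (if i.val = N - 1 then (1 : ℝ) else 0) + (if i.val = N then (1 : ℝ) else 0)) T (g 0) x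
            ∂((pinnedChain ω₂ lam β γ).gibbsMeasure (N + M) T) +
        γ ^ 2 / T ^ 2 * κ * ∫ x, gL (x.1, -x.2) * g 0 x ∂((pinnedChain ω₂ lam β γ).gibbsMeasure (N + M) T) := by
  obtain ⟨hg₀C, hg₀L, hpde₀⟩ := hg₀
  obtain ⟨hgLC, hgLL, -, hpdeL⟩ := hgL
  have hD := insertion_pairing hω hl hβ hγ hT κ hg₀C hg₀L hpde₀ hSK hgLC hgLL hpdeL
  rw [kuboMatrix_zero_zero_eq, plainKubo]
  have e : γ - γ ^ 2 / T ^ 2 * ∫ x, g 0 x * (kin (N + M) 0 x - T) ∂((pinnedChain ω₂ lam β γ).gibbsMeasure (N + M) T) -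
      γ * (1 - γ / T ^ 2 * ∫ x, gL x * (kin (N + M) 0 x - T) ∂((pinnedChain ω₂ lam β γ).gibbsMeasure (N + M) T)) =
      -(γ ^ 2 / T ^ 2) * ((∫ x, g 0 x * (kin (N + M) 0 x - T) ∂((pinnedChain ω₂ lam β γ).gibbsMeasure (N + M) T)) -
        ∫ x, gL x * (kin (N + M) 0 x - T) ∂((pinnedChain ω₂ lam β γ).gibbsMeasure (N + M) T)) := by ring
  rw [e, hD]
  ring

/-- Registered helper sub-goal `helper_insertionResolventIdentity` (= `kuboMatrix_zero_zero_sub_plainKubo_insertion` with every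
binder explicit and `bathOp` fully qualified): the exact κ-frame floating-probe insertion identity for bath `0`. -/
theorem helper_insertionResolventIdentity : ∀ (ω₂ lam β γ T : ℝ), 0 < ω₂ → 0 ≤ lam → 0 ≤ β → 0 < γ → 0 < T → ∀ (N M : ℕ) (κ : ℝ) (g : Fin 4 → PhaseSpace (N + M) → ℝ) (gL : PhaseSpace (N + M) → ℝ), g 0 ∈ deviceResolventFields ω₂ lam β γ T N M 0 κ → MemLp (Summit.AtomisticToContinuum.FouriersLaw.Theorems.SuperadditiveResistance.DeviceLiouville.bathOp (N + M) (fun i : Fin (N + M) => (if i.val = N - 1 then (1 : ℝ) else 0) + (if i.val = N then (1 : ℝ) else 0)) T (g 0)) 2 ((pinnedChain ω₂ lam β γ).gibbsMeasure (N + M) T) → gL ∈ plainForwardFields ω₂ lam β γ T (N + M) → kuboMatrix ω₂ lam β γ T N M g 0 0 - plainKubo ω₂ lam β γ T (N + M) gL = -(γ ^ 3 / T ^ 2) * ∫ x, gL (x.1, -x.2) * Summit.AtomisticToContinuum.FouriersLaw.Theorems.SuperadditiveResistance.DeviceLiouville.bathOp (N + M) (fun i : Fin (N + M) => (if i.val =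 N - 1 then (1 : ℝ) else 0) + (if i.val = N then (1 : ℝ) else 0)) T (g 0) x ∂((pinnedChain ω₂ lam β γ).gibbsMeasure (N + M) T) + γ ^ 2 / T ^ 2 * κ * ∫ x, gL (x.1, -x.2) * g 0 x ∂((pinnedChain ω₂ lam β γ).gibbsMeasure (N + M) T) :=
  fun _ _ _ _ _ hω hl hβ hγ hT _ _ κ g gL hg₀ hSK hgL =>
    kuboMatrix_zero_zero_sub_plainKubo_insertion hω hl hβ hγ hT κ g gL hg₀ hSK hgL

end Summit.AtomisticToContinuum.FouriersLaw.Cruxes.SuperadditiveResistance.FloatingProbeBypassLaplacian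

end
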